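/-
Copyright (c) 2026 the pub-hodgecm-mathlib formalisation cell (harness21).  Prover seat hodgecm-mathlib-LH4-p08 (g11) (valve hand), Track B «K2-LIT»,
#184♮ = hLiu418 = `stmt-HodgeConjecture-24832`; socket #41, KIND W — KW desk F0P2-p08 (g3) 2026-09-05T00:15:29Z (c): «(W2-mirror) the per-place archimedean
Whittaker letter at a NEGATIVE DEFINITE framed index (signature (0,2))»; census verdict 00:17:44Z («free via the block-sign conjugation, same `k`, same window»).
FILE 2 of 2 (the mirror and the letter).  THEOREMS ONLY (no `def`, no `instance`, no notation, no named-fact hypothesis, no `sorry`).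
-/
import Summits.HodgeConjecture.HodgeConjecture.Theorems.K2LiuKindWArchWhittakerLetterPic   -- FILE 1: ★ p863390 generic in the picture predicate
import Summits.HodgeConjecture.HodgeConjecture.Theorems.K2LiuSiegelStabBlocks              -- ★ `Stab(iI) = U(J) ∩ U(2l)`
import Mathlib.Algebra.MvPolynomial.Monad
import HarnessLib

/-!
# Crux `HLiu418`, socket #41, KIND W — `K2LiuKindWArchWhittakerLetterNegDef`: THE PER-PLACE ARCHIMEDEAN WHITTAKER LETTER `hW` AT A NEGATIVE DEFINITE
# FRAMED INDEX (signature (0,2)), by the block-sign mirror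

Cell `hodgecm-mathlib`, crux item hLiu418 = `stmt-HodgeConjecture-24832` (helper lane `--supports … --as helper`, count-neutral), route of record `HCCMUnconditional`;
squad K2 ∕ K2Liu, road `K2_Liu`, socket #41 `sig_K2LiuSiegelEisensteinContinuation`, KIND W.  ★ `K2LiuKindWArchWhittakerLetter.exists_twistedWhittaker_continuation_of_posDef`
pays ★ `K2LiuKindWArchContinuation`'s per-place letter `hW w` at a POSITIVE definite framed index.  THIS FILE pays it at a NEGATIVE definite framed index
(`(−hidx).PosDef`), with the SAME weight `k`, the SAME holomorphy window and the SAME by-value bridge `hKpic`, by the BLOCK-SIGN MIRROR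
`θ(y) := D·y·D`, `D = fromBlocks 1 0 0 (−1) = diag(1, 1, −1, −1)` (NO complex conjugation, so no `k ↦ −k` and no window shift):
`D J D = −J` ⇒ `θ(U(J)) = U(J)`; `θ(n(b)) = n(−b)`, `θ(p)₁₁ = p₁₁`, `θ(p)₂₁ = −p₂₁` ⇒ `F ∘ θ ∈ I_w(s, χ_k)` whenever `F ∈ I_w(s, χ_k)`; `θ(x) = (0 −B; −C 0)`;
`θ(Stab(iI)) = Stab(iI)` (★ `K2LiuSiegelStabBlocks`: `Stab(iI) = U(J) ∩ U(2l)`, `D` unitary); `hermOfReal (−r) = −hermOfReal r` and Lebesgue measure on the chart is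
`(−)`-invariant; `e(−tr(hidx·(−b))) = e(−tr((−hidx)·b))`; the polynomial K-pictures transport by the sign substitution `X_{pq} ↦ ε_p ε_q X_{pq}` (Mathlib `MvPolynomial.bind₁`).
* §2 the mirror letters;  * §3 **`exists_twistedWhittaker_continuation_of_negDef`** — EXACTLY ★ p863390's binders with `hpos : hidx.PosDef` replaced by
  `hneg : (-hidx).PosDef`, same conclusion bytes: `F = (F∘θ)∘θ`, substitute `r ↦ −r`, then FILE 1 at the positive index `−hidx` for the mirrored frame `(θx, θg)`,
  the mirrored picture `Pic s G := (picture of G∘θ is Q)` and the transported bridge (`kPicture_conjBlockSign`).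
What is NOT here (honest): signature (1,1) — the organ «Φ6b-ind» (Shimura 1982, Math. Ann. 260, Thm. 4.2), OPEN elsewhere; the bridge `hKpic` itself (W1).
[Shimura1997, §16.4, §18.4] [KudlaRallis1994, §1].
HONEST LABEL.  Count-neutral helper, closes no socket: `HC_CM` is proved only modulo the 7 printed citations (2 remaining named inputs: hLiu418 =
`stmt-HodgeConjecture-24832`, h413 = `stmt-HodgeConjecture-24833`) until rung 0 closes.
-/

set_option autoImplicit false
set_option linter.dupNamespace false -- the mandated namespace repeats `HodgeConjecture.HodgeConjecture`

noncomputable section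

open Complex Matrix MeasureTheory
open scoped ComplexConjugate ComplexOrder
open Literature.NumberTheory.ModularForms.SiegelUpperHalfSpace (moeb num denom moeb_def num_fromBlocks denom_fromBlocks)

namespace Summit.HodgeConjecture.HodgeConjecture.Cruxes.HLiu418.K2LiuKindWArchWhittakerLetterNegDef

open Summit.HodgeConjecture.HodgeConjecture.Cruxes.HLiu418.K2LiuHermTwoGammaDefs (hermTwo hermTwo_eq_of_isHermitian)
open Summit.HodgeConjecture.HodgeConjecture.Cruxes.HLiu418.K2LiuHermTwoEtaDefs (hermTwo_add)
open Summit.HodgeConjecture.HodgeConjecture.Cruxes.HLiu418.K2LiuHermitianTubeCocycle (mul_mem_UJ J_mem)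
open Summit.HodgeConjecture.HodgeConjecture.Cruxes.HLiu418.K2LiuHermitianTubeAction (exists_transl_levi_mul_stabilizer)
open Summit.HodgeConjecture.HodgeConjecture.Cruxes.HLiu418.K2LiuArchInducedTubeDefs
open Summit.HodgeConjecture.HodgeConjecture.Cruxes.HLiu418.K2LiuU22CompactPictureDefs
open Summit.HodgeConjecture.HodgeConjecture.Cruxes.HLiu418.K2LiuArchWhittakerLeviEquivariance
open Summit.HodgeConjecture.HodgeConjecture.Cruxes.HLiu418.K2LiuArchIntertwiningScalarValue (integral_hermOfReal_eq)
open Summit.HodgeConjecture.HodgeConjecture.Cruxes.HLiu418.K2LiuArchBlockOfFrame (antidiag_letters antidiag_eq_J_mul_levi levi_mul_transl)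
open Summit.HodgeConjecture.HodgeConjecture.Cruxes.HLiu418.K2LiuKFiniteSectionWhittakerHolomorphyGrowth (kFiniteSection_whittaker_holomorphy_growth)
open Summit.HodgeConjecture.HodgeConjecture.Cruxes.HLiu418.K2LiuSiegelStabBlocks (mem_unitaryGroup_of_stab moeb_I_eq_I_of_mem_unitaryGroup)
open Summit.HodgeConjecture.HodgeConjecture.Cruxes.HLiu418.K2LiuKindWArchWhittakerLetterPic (exists_twistedWhittaker_continuation_of_posDef_pic)

/-! ## §2 The block-sign mirror `θ(y) = D·y·D`, `D = fromBlocks 1 0 0 (−1) = diag(1, 1, −1, −1)` -/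

/-- `D·D = 1`. [folklore] -/
theorem blockSign_mul_blockSign :
    (fromBlocks 1 0 0 (-1) : Matrix (Fin 2 ⊕ Fin 2) (Fin 2 ⊕ Fin 2) ℂ) * fromBlocks 1 0 0 (-1) = 1 := by
  rw [fromBlocks_multiply]
  simp only [Matrix.mul_zero, add_zero, zero_add, Matrix.mul_one, Matrix.mul_neg, neg_neg, neg_zero, fromBlocks_one]

/-- `D·(D·X) = X`. [folklore] -/
theorem blockSign_mul_blockSign_mul (X : Matrix (Fin 2 ⊕ Fin 2) (Fin 2 ⊕ Fin 2) ℂ) :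
    (fromBlocks 1 0 0 (-1) : Matrix (Fin 2 ⊕ Fin 2) (Fin 2 ⊕ Fin 2) ℂ) * (fromBlocks 1 0 0 (-1) * X) = X := by
  rw [← Matrix.mul_assoc, blockSign_mul_blockSign, Matrix.one_mul]

/-- `Dᴴ = D`. [folklore] -/
theorem conjTranspose_blockSign :
    (fromBlocks 1 0 0 (-1) : Matrix (Fin 2 ⊕ Fin 2) (Fin 2 ⊕ Fin 2) ℂ)ᴴ = fromBlocks 1 0 0 (-1) := by
  rw [fromBlocks_conjTranspose, conjTranspose_one, conjTranspose_zero, conjTranspose_neg, conjTranspose_one]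

/-- `D` is unitary. [folklore] -/
theorem blockSign_mem_unitaryGroup :
    (fromBlocks 1 0 0 (-1) : Matrix (Fin 2 ⊕ Fin 2) (Fin 2 ⊕ Fin 2) ℂ) ∈ Matrix.unitaryGroup (Fin 2 ⊕ Fin 2) ℂ := by
  rw [Matrix.mem_unitaryGroup_iff, star_eq_conjTranspose, conjTranspose_blockSign, blockSign_mul_blockSign]

/-- `D·(a b; c d)·D = (a −b; −c d)`. [folklore] -/
theorem blockSign_mul_fromBlocks_mul_blockSign (a b c d : Matrix (Fin 2) (Fin 2) ℂ) :
    (fromBlocks 1 0 0 (-1) : Matrix (Fin 2 ⊕ Fin 2) (Fin 2 ⊕ Fin 2) ℂ) * fromBlocks a b c d * fromBlocks 1 0 0 (-1) =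
      fromBlocks a (-b) (-c) d := by
  rw [fromBlocks_multiply, fromBlocks_multiply]
  simp only [Matrix.mul_zero, Matrix.zero_mul, add_zero, zero_add, Matrix.one_mul, Matrix.mul_one, Matrix.neg_mul, Matrix.mul_neg,
    neg_neg]

/-- `D·(0 B; C 0)·D = (0 −B; −C 0)`: the mirror of an antidiagonal frame element. [folklore] -/
theorem blockSign_mul_antidiag_mul_blockSign (B C : Matrix (Fin 2) (Fin 2) ℂ) :
    (fromBlocks 1 0 0 (-1) : Matrix (Fin 2 ⊕ Fin 2) (Fin 2 ⊕ Fin 2) ℂ) * fromBlocks 0 B C 0 * fromBlocks 1 0 0 (-1) =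
      fromBlocks 0 (-B) (-C) 0 := by
  rw [blockSign_mul_fromBlocks_mul_blockSign]

/-- `D·n(b)·D = n(−b)`: the mirror of a translation. [folklore] -/
theorem blockSign_mul_transl_mul_blockSign (b : Matrix (Fin 2) (Fin 2) ℂ) :
    (fromBlocks 1 0 0 (-1) : Matrix (Fin 2 ⊕ Fin 2) (Fin 2 ⊕ Fin 2) ℂ) * fromBlocks 1 b 0 1 * fromBlocks 1 0 0 (-1) =
      fromBlocks 1 (-b) 0 1 := by
  rw [blockSign_mul_fromBlocks_mul_blockSign, neg_zero]

/-- `D·J·D = −J`. [folklore] -/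
theorem blockSign_mul_J_mul_blockSign :
    (fromBlocks 1 0 0 (-1) : Matrix (Fin 2 ⊕ Fin 2) (Fin 2 ⊕ Fin 2) ℂ) * Matrix.J (Fin 2) ℂ * fromBlocks 1 0 0 (-1) =
      -Matrix.J (Fin 2) ℂ := by
  rw [Matrix.J, blockSign_mul_fromBlocks_mul_blockSign, fromBlocks_neg, neg_zero]

/-- **`θ(U(J)) = U(J)`**: `g ∈ U(J) ⇒ D·g·D ∈ U(J)`. [Shimura1997, §5] -/
theorem conjBlockSign_mem_UJ {g : Matrix (Fin 2 ⊕ Fin 2) (Fin 2 ⊕ Fin 2) ℂ} (hg : gᴴ * Matrix.J (Fin 2) ℂ * g = Matrix.J (Fin 2) ℂ) :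
    ((fromBlocks 1 0 0 (-1) : Matrix (Fin 2 ⊕ Fin 2) (Fin 2 ⊕ Fin 2) ℂ) * g * fromBlocks 1 0 0 (-1))ᴴ * Matrix.J (Fin 2) ℂ *
        ((fromBlocks 1 0 0 (-1) : Matrix (Fin 2 ⊕ Fin 2) (Fin 2 ⊕ Fin 2) ℂ) * g * fromBlocks 1 0 0 (-1)) =
      Matrix.J (Fin 2) ℂ := by
  rw [conjTranspose_mul, conjTranspose_mul, conjTranspose_blockSign]
  calc (fromBlocks 1 0 0 (-1) : Matrix (Fin 2 ⊕ Fin 2) (Fin 2 ⊕ Fin 2) ℂ) * (gᴴ * fromBlocks 1 0 0 (-1)) * Matrix.J (Fin 2) ℂ *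
          ((fromBlocks 1 0 0 (-1) : Matrix (Fin 2 ⊕ Fin 2) (Fin 2 ⊕ Fin 2) ℂ) * g * fromBlocks 1 0 0 (-1))
        = fromBlocks 1 0 0 (-1) * gᴴ *
            ((fromBlocks 1 0 0 (-1) : Matrix (Fin 2 ⊕ Fin 2) (Fin 2 ⊕ Fin 2) ℂ) * Matrix.J (Fin 2) ℂ * fromBlocks 1 0 0 (-1)) *
            g * fromBlocks 1 0 0 (-1) := by
          simp only [Matrix.mul_assoc]
    _ = -(fromBlocks 1 0 0 (-1) * (gᴴ * Matrix.J (Fin 2) ℂ * g) * fromBlocks 1 0 0 (-1)) := by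
          rw [blockSign_mul_J_mul_blockSign]
          simp only [Matrix.mul_neg, Matrix.neg_mul, Matrix.mul_assoc]
    _ = Matrix.J (Fin 2) ℂ := by rw [hg, blockSign_mul_J_mul_blockSign, neg_neg]

/-- **`θ(Stab(iI)) = Stab(iI)`**: `Stab(iI) = U(J) ∩ U(2l)` (★ `K2LiuSiegelStabBlocks`) and `D` is unitary. [Shimura1997, §6.5] -/
theorem moeb_conjBlockSign_I {u : Matrix (Fin 2 ⊕ Fin 2) (Fin 2 ⊕ Fin 2) ℂ} (hu : uᴴ * Matrix.J (Fin 2) ℂ * u = Matrix.J (Fin 2) ℂ)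
    (hui : moeb u (I • (1 : Matrix (Fin 2) (Fin 2) ℂ)) = I • 1) :
    moeb ((fromBlocks 1 0 0 (-1) : Matrix (Fin 2 ⊕ Fin 2) (Fin 2 ⊕ Fin 2) ℂ) * u * fromBlocks 1 0 0 (-1)) (I • (1 : Matrix (Fin 2) (Fin 2) ℂ)) =
      I • 1 :=
  moeb_I_eq_I_of_mem_unitaryGroup (conjBlockSign_mem_UJ hu)
    (mul_mem (mul_mem blockSign_mem_unitaryGroup (mem_unitaryGroup_of_stab hu hui)) blockSign_mem_unitaryGroup)

/-- **`F ∈ I_w(s, χ) ⇒ F ∘ θ ∈ I_w(s, χ)`** (same `χ`, same `s`): `θ` preserves the Siegel parabolic, `θ(p)₁₁ = p₁₁`, `θ(p)₂₁ = −p₂₁`. [Shimura1997, §16] -/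
theorem isArchSiegelSection_conjBlockSign {χ : ℂ → ℂ} {s : ℂ} {F : Matrix (Fin 2 ⊕ Fin 2) (Fin 2 ⊕ Fin 2) ℂ → ℂ} (hF : IsArchSiegelSection χ s F) :
    IsArchSiegelSection χ s
      (fun y => F ((fromBlocks 1 0 0 (-1) : Matrix (Fin 2 ⊕ Fin 2) (Fin 2 ⊕ Fin 2) ℂ) * y * fromBlocks 1 0 0 (-1))) := by
  intro p g hp hp21
  have hpD : (fromBlocks 1 0 0 (-1) : Matrix (Fin 2 ⊕ Fin 2) (Fin 2 ⊕ Fin 2) ℂ) * p * fromBlocks 1 0 0 (-1) =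
      fromBlocks p.toBlocks₁₁ (-p.toBlocks₁₂) (-p.toBlocks₂₁) p.toBlocks₂₂ := by
    conv_lhs => rw [← fromBlocks_toBlocks p]
    rw [blockSign_mul_fromBlocks_mul_blockSign]
  have h21 : ((fromBlocks 1 0 0 (-1) : Matrix (Fin 2 ⊕ Fin 2) (Fin 2 ⊕ Fin 2) ℂ) * p * fromBlocks 1 0 0 (-1)).toBlocks₂₁ = 0 := by
    rw [hpD, toBlocks_fromBlocks₂₁, hp21, neg_zero]
  have h11 : ((fromBlocks 1 0 0 (-1) : Matrix (Fin 2 ⊕ Fin 2) (Fin 2 ⊕ Fin 2) ℂ) * p * fromBlocks 1 0 0 (-1)).toBlocks₁₁ = p.toBlocks₁₁ := by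
    rw [hpD, toBlocks_fromBlocks₁₁]
  have e : (fromBlocks 1 0 0 (-1) : Matrix (Fin 2 ⊕ Fin 2) (Fin 2 ⊕ Fin 2) ℂ) * (p * g) * fromBlocks 1 0 0 (-1) =
      (fromBlocks 1 0 0 (-1) : Matrix (Fin 2 ⊕ Fin 2) (Fin 2 ⊕ Fin 2) ℂ) * p * fromBlocks 1 0 0 (-1) *
        ((fromBlocks 1 0 0 (-1) : Matrix (Fin 2 ⊕ Fin 2) (Fin 2 ⊕ Fin 2) ℂ) * g * fromBlocks 1 0 0 (-1)) := by
    simp only [Matrix.mul_assoc, blockSign_mul_blockSign_mul]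
  simp only
  rw [e, hF _ _ (conjBlockSign_mem_UJ hp) h21, h11]

/-- The entries of `θ(u) = D·u·D`: `θ(u)_{pq} = ε_p · u_{pq} · ε_q`, `ε = (1, 1, −1, −1)`. [folklore] -/
theorem conjBlockSign_apply (u : Matrix (Fin 2 ⊕ Fin 2) (Fin 2 ⊕ Fin 2) ℂ) (p q : Fin 2 ⊕ Fin 2) :
    (((fromBlocks 1 0 0 (-1) : Matrix (Fin 2 ⊕ Fin 2) (Fin 2 ⊕ Fin 2) ℂ) * u * fromBlocks 1 0 0 (-1) :
        Matrix (Fin 2 ⊕ Fin 2) (Fin 2 ⊕ Fin 2) ℂ)) p q =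
      Sum.elim (fun _ => (1 : ℂ)) (fun _ => -1) p * u p q * Sum.elim (fun _ => (1 : ℂ)) (fun _ => -1) q := by
  have hD : (fromBlocks 1 0 0 (-1) : Matrix (Fin 2 ⊕ Fin 2) (Fin 2 ⊕ Fin 2) ℂ) = diagonal (Sum.elim (fun _ => (1 : ℂ)) (fun _ => -1)) := by
    rw [← fromBlocks_diagonal, diagonal_one, ← diagonal_one, diagonal_neg]
  rw [hD, mul_diagonal, diagonal_mul]

/-- `hermOfReal (−r) = −hermOfReal r` (the chart is linear). [folklore] -/
theorem hermOfReal_neg (r : Fin 2 → Fin 2 → ℝ) : hermOfReal (-r) = -hermOfReal r := by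
  ext i j
  simp only [hermOfReal_apply, Matrix.neg_apply, Pi.neg_apply]
  push_cast
  ring

/-- **THE MIRROR OF THE BRIDGE `hKpic`.**  If every `F ∈ I_w(s, χ_k)` with compact picture `Pic s F` has a polynomial K-picture on `Stab(iI)·k₀` (all
`k₀ ∈ Stab(iI)`), then so does every `G ∈ I_w(s, χ_k)` whose mirror `G ∘ θ` has picture `Pic s (G ∘ θ)`: use the bridge at `θ(k₀)` for `G ∘ θ` at `θ(u)`
(`θ` is an involution of `Stab(iI)`), and substitute the signs `ε_p ε_q` into the polynomial. [Shimura1997, §16.4] -/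
theorem kPicture_conjBlockSign {k : ℤ} (Pic : ℂ → (Matrix (Fin 2 ⊕ Fin 2) (Fin 2 ⊕ Fin 2) ℂ → ℂ) → Prop)
    (hKpic : ∀ k₀ : Matrix (Fin 2 ⊕ Fin 2) (Fin 2 ⊕ Fin 2) ℂ, k₀ᴴ * Matrix.J (Fin 2) ℂ * k₀ = Matrix.J (Fin 2) ℂ →
      moeb k₀ (I • (1 : Matrix (Fin 2) (Fin 2) ℂ)) = I • 1 →
      ∃ P : MvPolynomial (((Fin 2 ⊕ Fin 2) × (Fin 2 ⊕ Fin 2)) ⊕ ((Fin 2 ⊕ Fin 2) × (Fin 2 ⊕ Fin 2))) ℂ,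
        ∀ (s : ℂ) (F : Matrix (Fin 2 ⊕ Fin 2) (Fin 2 ⊕ Fin 2) ℂ → ℂ), IsArchSiegelSection (fun z : ℂ => (conj z / ((‖z‖ : ℝ) : ℂ)) ^ k) s F →
          Pic s F →
          ∀ u : Matrix (Fin 2 ⊕ Fin 2) (Fin 2 ⊕ Fin 2) ℂ, uᴴ * Matrix.J (Fin 2) ℂ * u = Matrix.J (Fin 2) ℂ → moeb u (I • (1 : Matrix (Fin 2) (Fin 2) ℂ)) = I • 1 →
            F (u * k₀) = MvPolynomial.eval (Sum.elim (fun pq => u pq.1 pq.2) (fun pq => conj (u pq.1 pq.2))) P) :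
    ∀ k₀ : Matrix (Fin 2 ⊕ Fin 2) (Fin 2 ⊕ Fin 2) ℂ, k₀ᴴ * Matrix.J (Fin 2) ℂ * k₀ = Matrix.J (Fin 2) ℂ →
      moeb k₀ (I • (1 : Matrix (Fin 2) (Fin 2) ℂ)) = I • 1 →
      ∃ P : MvPolynomial (((Fin 2 ⊕ Fin 2) × (Fin 2 ⊕ Fin 2)) ⊕ ((Fin 2 ⊕ Fin 2) × (Fin 2 ⊕ Fin 2))) ℂ,
        ∀ (s : ℂ) (G : Matrix (Fin 2 ⊕ Fin 2) (Fin 2 ⊕ Fin 2) ℂ → ℂ), IsArchSiegelSection (fun z : ℂ => (conj z / ((‖z‖ : ℝ) : ℂ)) ^ k) s G →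
          Pic s (fun y => G ((fromBlocks 1 0 0 (-1) : Matrix (Fin 2 ⊕ Fin 2) (Fin 2 ⊕ Fin 2) ℂ) * y * fromBlocks 1 0 0 (-1))) →
          ∀ u : Matrix (Fin 2 ⊕ Fin 2) (Fin 2 ⊕ Fin 2) ℂ, uᴴ * Matrix.J (Fin 2) ℂ * u = Matrix.J (Fin 2) ℂ → moeb u (I • (1 : Matrix (Fin 2) (Fin 2) ℂ)) = I • 1 →
            G (u * k₀) = MvPolynomial.eval (Sum.elim (fun pq => u pq.1 pq.2) (fun pq => conj (u pq.1 pq.2))) P := by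
  intro k₀ hk₀ hk₀i
  obtain ⟨P, hP⟩ := hKpic _ (conjBlockSign_mem_UJ hk₀) (moeb_conjBlockSign_I hk₀ hk₀i)
  refine ⟨MvPolynomial.bind₁
      (fun i => MvPolynomial.C (Sum.elim
          (fun pq : (Fin 2 ⊕ Fin 2) × (Fin 2 ⊕ Fin 2) => Sum.elim (fun _ => (1 : ℂ)) (fun _ => -1) pq.1 * Sum.elim (fun _ => (1 : ℂ)) (fun _ => -1) pq.2)
          (fun pq : (Fin 2 ⊕ Fin 2) × (Fin 2 ⊕ Fin 2) => Sum.elim (fun _ => (1 : ℂ)) (fun _ => -1) pq.1 * Sum.elim (fun _ => (1 : ℂ)) (fun _ => -1) pq.2) i) *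
        MvPolynomial.X i) P, ?_⟩
  intro s G hG hPic u hu hui
  have h : G (u * k₀) = MvPolynomial.eval
      (Sum.elim
        (fun pq : (Fin 2 ⊕ Fin 2) × (Fin 2 ⊕ Fin 2) =>
          (((fromBlocks 1 0 0 (-1) : Matrix (Fin 2 ⊕ Fin 2) (Fin 2 ⊕ Fin 2) ℂ) * u * fromBlocks 1 0 0 (-1) :
            Matrix (Fin 2 ⊕ Fin 2) (Fin 2 ⊕ Fin 2) ℂ)) pq.1 pq.2)
        (fun pq : (Fin 2 ⊕ Fin 2) × (Fin 2 ⊕ Fin 2) =>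
          conj ((((fromBlocks 1 0 0 (-1) : Matrix (Fin 2 ⊕ Fin 2) (Fin 2 ⊕ Fin 2) ℂ) * u * fromBlocks 1 0 0 (-1) :
            Matrix (Fin 2 ⊕ Fin 2) (Fin 2 ⊕ Fin 2) ℂ)) pq.1 pq.2))) P := by
    have h0 := hP s _ (isArchSiegelSection_conjBlockSign hG) hPic _ (conjBlockSign_mem_UJ hu) (moeb_conjBlockSign_I hu hui)
    simpa only [Matrix.mul_assoc, blockSign_mul_blockSign_mul, blockSign_mul_blockSign, Matrix.mul_one] using h0
  -- evaluating a sign-substituted polynomial: `eval x (P(c·X)) = eval (c·x) P` (Mathlib `MvPolynomial.aeval_bind₁`)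
  have hev : ∀ (c x : ((Fin 2 ⊕ Fin 2) × (Fin 2 ⊕ Fin 2)) ⊕ ((Fin 2 ⊕ Fin 2) × (Fin 2 ⊕ Fin 2)) → ℂ)
      (R : MvPolynomial (((Fin 2 ⊕ Fin 2) × (Fin 2 ⊕ Fin 2)) ⊕ ((Fin 2 ⊕ Fin 2) × (Fin 2 ⊕ Fin 2))) ℂ),
      MvPolynomial.eval x (MvPolynomial.bind₁ (fun i => MvPolynomial.C (c i) * MvPolynomial.X i) R) =
        MvPolynomial.eval (fun i => c i * x i) R := by
    intro c x R
    have h1 : ∀ (y : ((Fin 2 ⊕ Fin 2) × (Fin 2 ⊕ Fin 2)) ⊕ ((Fin 2 ⊕ Fin 2) × (Fin 2 ⊕ Fin 2)) → ℂ)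
        (R' : MvPolynomial (((Fin 2 ⊕ Fin 2) × (Fin 2 ⊕ Fin 2)) ⊕ ((Fin 2 ⊕ Fin 2) × (Fin 2 ⊕ Fin 2))) ℂ),
        MvPolynomial.eval y R' = MvPolynomial.aeval y R' := fun _ _ => rfl
    have h2 : (fun i => MvPolynomial.aeval x (MvPolynomial.C (c i) * MvPolynomial.X i)) = fun i => c i * x i := by
      funext i
      rw [← h1, map_mul, MvPolynomial.eval_C, MvPolynomial.eval_X]
    rw [h1, h1, MvPolynomial.aeval_bind₁, h2]
  rw [h, hev]
  refine congrArg (fun x => MvPolynomial.eval x P) ?_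
  funext i
  rcases i with pq | pq
  · simp only [Sum.elim_inl, conjBlockSign_apply]
    ring
  · simp only [Sum.elim_inr, conjBlockSign_apply, map_mul]
    have hε : ∀ p : Fin 2 ⊕ Fin 2, conj (Sum.elim (fun _ => (1 : ℂ)) (fun _ => -1) p) = Sum.elim (fun _ => (1 : ℂ)) (fun _ => -1) p := by
      rintro (p | p)
      · simp only [Sum.elim_inl, map_one]
      · simp only [Sum.elim_inr, map_neg, map_one]
    rw [hε, hε]
    ring

/-! ## §3 The letter at a NEGATIVE definite framed index -/

/-- **THE PER-PLACE ARCHIMEDEAN WHITTAKER LETTER `hW w` AT A NEGATIVE DEFINITE FRAMED INDEX (signature (0,2)).**  EXACTLY ★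
`K2LiuKindWArchWhittakerLetter.exists_twistedWhittaker_continuation_of_posDef` with `hpos : hidx.PosDef` replaced by `hneg : (-hidx).PosDef` (same weight
`k ≥ −2`, same frame data, same twist reading `eb = e(−tr(hidx·b))`, the SAME by-value bridge `hKpic`, same conclusion): the twisted unipotent integral of every
flat section with compact picture `Q` over `x · N_{w,∞} · g`, `x = (0 B; C 0)`, continues holomorphically to `{re s > 0}` with ONE continuation `Ew`.
PROOF (the block-sign mirror): `F = (F∘θ)∘θ`, `θ(x·n(b)·g) = θ(x)·n(−b)·θ(g)`; substitute `r ↦ −r` on the chart (`hermOfReal` is linear, Lebesgue measure is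
`(−)`-invariant); the result is the twisted integral of `F∘θ ∈ I_w(s, χ_k)` over `θ(x)·N·θ(g)` against `e(−tr((−hidx)·b))`, `−hidx ≻ 0` — §1 with the mirrored
picture predicate and the mirrored bridge (`kPicture_conjBlockSign`). [cite: Shimura1997, §16.4, §18.4] [cite: KudlaRallis1994, §1] -/
theorem exists_twistedWhittaker_continuation_of_negDef {k : ℤ} (hk : -2 ≤ k) (Q : Carrier)
    {B C : Matrix (Fin 2) (Fin 2) ℂ}
    (hx : (fromBlocks 0 B C 0 : Matrix (Fin 2 ⊕ Fin 2) (Fin 2 ⊕ Fin 2) ℂ)ᴴ * Matrix.J (Fin 2) ℂ * (fromBlocks 0 B C 0 : Matrix (Fin 2 ⊕ Fin 2) (Fin 2 ⊕ Fin 2) ℂ) =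
      Matrix.J (Fin 2) ℂ)
    {g : Matrix (Fin 2 ⊕ Fin 2) (Fin 2 ⊕ Fin 2) ℂ} (hg : gᴴ * Matrix.J (Fin 2) ℂ * g = Matrix.J (Fin 2) ℂ)
    {hidx : Matrix (Fin 2) (Fin 2) ℂ} (hneg : (-hidx).PosDef)
    {eb : Matrix (Fin 2) (Fin 2) ℂ → ℂ} (heb : ∀ b, eb b = cexp (-(2 * Real.pi * I) * (hidx * b).trace))
    (hKpic : ∀ k₀ : Matrix (Fin 2 ⊕ Fin 2) (Fin 2 ⊕ Fin 2) ℂ, k₀ᴴ * Matrix.J (Fin 2) ℂ * k₀ = Matrix.J (Fin 2) ℂ →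
      moeb k₀ (I • (1 : Matrix (Fin 2) (Fin 2) ℂ)) = I • 1 →
      ∃ P : MvPolynomial (((Fin 2 ⊕ Fin 2) × (Fin 2 ⊕ Fin 2)) ⊕ ((Fin 2 ⊕ Fin 2) × (Fin 2 ⊕ Fin 2))) ℂ,
        ∀ (s : ℂ) (F : Matrix (Fin 2 ⊕ Fin 2) (Fin 2 ⊕ Fin 2) ℂ → ℂ), IsArchSiegelSection (fun z : ℂ => (conj z / ((‖z‖ : ℝ) : ℂ)) ^ k) s F →
          (∀ (v : Matrix (Fin 2) (Fin 2) ℂ), vᴴ * v = 1 → ∀ hv : v.det ≠ 0,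
            F ((2 : ℂ)⁻¹ • fromBlocks (1 + v) (-(I • (1 - v))) (I • (1 - v)) (1 + v) : Matrix (Fin 2 ⊕ Fin 2) (Fin 2 ⊕ Fin 2) ℂ) = evalAt v hv Q) →
          ∀ u : Matrix (Fin 2 ⊕ Fin 2) (Fin 2 ⊕ Fin 2) ℂ, uᴴ * Matrix.J (Fin 2) ℂ * u = Matrix.J (Fin 2) ℂ → moeb u (I • (1 : Matrix (Fin 2) (Fin 2) ℂ)) = I • 1 →
            F (u * k₀) = MvPolynomial.eval (Sum.elim (fun pq => u pq.1 pq.2) (fun pq => conj (u pq.1 pq.2))) P) :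
    ∃ (Ew : ℂ → ℂ) (s₀ : ℝ), DifferentiableOn ℂ Ew {s : ℂ | 0 < s.re} ∧ ∀ s : ℂ, s₀ < s.re →
      ∀ F : Matrix (Fin 2 ⊕ Fin 2) (Fin 2 ⊕ Fin 2) ℂ → ℂ, IsArchSiegelSection (fun z : ℂ => (conj z / ((‖z‖ : ℝ) : ℂ)) ^ k) s F →
        (∀ (v : Matrix (Fin 2) (Fin 2) ℂ), vᴴ * v = 1 → ∀ hv : v.det ≠ 0,
          F ((2 : ℂ)⁻¹ • fromBlocks (1 + v) (-(I • (1 - v))) (I • (1 - v)) (1 + v) : Matrix (Fin 2 ⊕ Fin 2) (Fin 2 ⊕ Fin 2) ℂ) = evalAt v hv Q) →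
        ∫ r : Fin 2 → Fin 2 → ℝ, F ((fromBlocks 0 B C 0 : Matrix (Fin 2 ⊕ Fin 2) (Fin 2 ⊕ Fin 2) ℂ) * fromBlocks 1 (hermOfReal r) 0 1 * g) * eb (hermOfReal r) =
          Ew s := by
  -- the mirrored frame `(θx, θg)`, the positive index `−hidx`, the mirrored twist, picture and bridge
  have hx' : (fromBlocks 0 (-B) (-C) 0 : Matrix (Fin 2 ⊕ Fin 2) (Fin 2 ⊕ Fin 2) ℂ)ᴴ * Matrix.J (Fin 2) ℂ *
      (fromBlocks 0 (-B) (-C) 0 : Matrix (Fin 2 ⊕ Fin 2) (Fin 2 ⊕ Fin 2) ℂ) = Matrix.J (Fin 2) ℂ := by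
    have h := conjBlockSign_mem_UJ hx
    rwa [blockSign_mul_antidiag_mul_blockSign] at h
  have heb' : ∀ b : Matrix (Fin 2) (Fin 2) ℂ, (fun b' : Matrix (Fin 2) (Fin 2) ℂ => eb (-b')) b = cexp (-(2 * Real.pi * I) * (-hidx * b).trace) := by
    intro b
    simp only [heb, Matrix.neg_mul, Matrix.mul_neg]
  obtain ⟨Ew, s₀, hhol, hEw⟩ := exists_twistedWhittaker_continuation_of_posDef_pic hk
    (fun (s : ℂ) (G : Matrix (Fin 2 ⊕ Fin 2) (Fin 2 ⊕ Fin 2) ℂ → ℂ) => ∀ (v : Matrix (Fin 2) (Fin 2) ℂ), vᴴ * v = 1 → ∀ hv : v.det ≠ 0,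
      G ((fromBlocks 1 0 0 (-1) : Matrix (Fin 2 ⊕ Fin 2) (Fin 2 ⊕ Fin 2) ℂ) *
          ((2 : ℂ)⁻¹ • fromBlocks (1 + v) (-(I • (1 - v))) (I • (1 - v)) (1 + v) : Matrix (Fin 2 ⊕ Fin 2) (Fin 2 ⊕ Fin 2) ℂ) * fromBlocks 1 0 0 (-1)) =
        evalAt v hv Q)
    hx' (conjBlockSign_mem_UJ hg) hneg heb'
    (kPicture_conjBlockSign (k := k)
      (fun (s : ℂ) (F : Matrix (Fin 2 ⊕ Fin 2) (Fin 2 ⊕ Fin 2) ℂ → ℂ) => ∀ (v : Matrix (Fin 2) (Fin 2) ℂ), vᴴ * v = 1 → ∀ hv : v.det ≠ 0,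
        F ((2 : ℂ)⁻¹ • fromBlocks (1 + v) (-(I • (1 - v))) (I • (1 - v)) (1 + v) : Matrix (Fin 2 ⊕ Fin 2) (Fin 2 ⊕ Fin 2) ℂ) = evalAt v hv Q)
      hKpic)
  refine ⟨Ew, s₀, hhol, fun s hs F hF hFQ => ?_⟩
  -- `F = (F∘θ)∘θ`, `F∘θ` is flat with the mirrored picture
  have key := hEw s hs (fun y => F ((fromBlocks 1 0 0 (-1) : Matrix (Fin 2 ⊕ Fin 2) (Fin 2 ⊕ Fin 2) ℂ) * y * fromBlocks 1 0 0 (-1)))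
    (isArchSiegelSection_conjBlockSign hF)
    (fun v hv hdv => by
      simpa only [Matrix.mul_assoc, blockSign_mul_blockSign_mul, blockSign_mul_blockSign, Matrix.mul_one] using hFQ v hv hdv)
  rw [← key]
  -- substitute `r ↦ −r` on the chart
  refine Eq.trans ?_ (integral_neg_eq_self _ volume)
  congr 1
  funext r
  simp only [hermOfReal_neg, neg_neg]
  rw [← blockSign_mul_antidiag_mul_blockSign B C, ← blockSign_mul_transl_mul_blockSign (hermOfReal r)]
  simp only [Matrix.mul_assoc, blockSign_mul_blockSign_mul, blockSign_mul_blockSign, Matrix.mul_one]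

end Summit.HodgeConjecture.HodgeConjecture.Cruxes.HLiu418.K2LiuKindWArchWhittakerLetterNegDef

end
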